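import Summits.HubbardSuperconductivity.HubbardSuperconductivity.Theorems.AnisotropyChordTransferFibre3KT2bRow
import Summits.HubbardSuperconductivity.HubbardSuperconductivity.Theorems.AnisotropyChordTransferFibre3QuasiNull
import Summits.HubbardSuperconductivity.HubbardSuperconductivity.Theorems.AnisotropyChordTransferFibre3GroundSup
import Summits.HubbardSuperconductivity.HubbardSuperconductivity.Theorems.AnisotropyChordTransferFibre3LamPart

/-!
# Route `AnisotropyChord` / H0 rotor rung: PartN41-C §4 — `KernelSubadditive` PROVED (`a₀(r + r′) ≤ a₀(r) + a₀(r′)`, every `L`)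

Theory-1 g22's PartN41-C §4 `KernelSubadditive` (port …Fibre3KT2bRow), by the DISCRETE MINIMUM PRINCIPLE instead of the
killed-walk argument of the statement file: for fixed `r′` the function `h(x) = a₀(x) + a₀(r′) − a₀(x + r′)` has lattice
Laplacian `Σ_e h(x+e) − 4h(x) = δ_{x,0} − δ_{x,−r′}` (the zero-mode terms `−1/V` of `KernelHarmonicity` cancel), so `h` is
harmonic off `{0, −r′}` and sub-harmonic at `0`; a minimiser off `{0,−r′}` propagates the minimum to its four neighbours
(★ `min_propagates`), hence — the two lattice generators reaching every site — to the whole torus, so the minimum is attained on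
`{0, −r′}` where `h = 0`, resp. `h = 2a₀(r′) ≥ 0` (`a₀ ≥ 0` from `|G̃(r)| ≤ G̃(0)`).  ★ `RowC.kernel_subadditive`,
★ `kernelSubadditive_holds : KernelSubadditive L` (no hypothesis on `L`; `L = 1` is degenerate).
Prover seat `hubbard-h0-rotor-p1` g27 (route lead); helper for stmt-HubbardSuperconductivity-23918 (`--supports`, helper class).
WHAT THIS IS NOT: nothing here proves superconductivity in the Hubbard model; a property of the free lattice kernel used by ONE
row of ONE conditional reduction.  Tree imports only; no new definitions; no sorry, no axioms.
-/

set_option linter.dupNamespace false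
set_option autoImplicit false

noncomputable section

open scoped BigOperators

namespace Summit.HubbardSuperconductivity.HubbardSuperconductivity.Theorems.AnisotropyChord.Transfer.Fibre3

variable (L : ℕ) [NeZero L]

namespace RowC

/-- `a₀ ≥ 0` (`L ≥ 2`). [folklore] -/
theorem aKer_zero_nonneg (hL : 2 ≤ L) (r : Tor L) : 0 ≤ aKer L 0 r := by
  have h := abs_Gres_le L hL (lam2 := 0) (by linarith [RateLemma.eps1_pos_of_two_le L hL]) r
  have := le_abs_self (Gres L 0 r)
  unfold aKer; linarith

/-- the lattice Laplacian of `a₀`: `Σ_e a₀(x+e) = 4a₀(x) + δ_{x,0} − 1/V` (`L ≥ 2`). [folklore] -/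
theorem nn_sum_aKer_zero (hL : 2 ≤ L) (x : Tor L) :
    ((nnList L).map (fun e => aKer L 0 (x + e))).sum
      = 4 * aKer L 0 x + (if x = 0 then (1 : ℝ) else 0) - 1 / (L : ℝ) ^ 2 := by
  have h := kernelHarmonicity_holds L 0 le_rfl (by linarith [RateLemma.eps1_pos_of_two_le L hL]) x
  rw [h]; ring

/-- ★ PROPAGATION: a minimiser of `h(x) = a₀(x) + a₀(r′) − a₀(x+r′)` off `{0, −r′}` passes the minimum to its four
neighbours. [folklore] -/
theorem min_propagates (hL : 2 ≤ L) (r' : Tor L) {m : ℝ}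
    (hmin : ∀ x : Tor L, m ≤ aKer L 0 x + aKer L 0 r' - aKer L 0 (x + r'))
    {x : Tor L} (hx : aKer L 0 x + aKer L 0 r' - aKer L 0 (x + r') = m) (hx0 : x ≠ 0) (hxr : x ≠ -r') :
    aKer L 0 (x + ex L) + aKer L 0 r' - aKer L 0 (x + ex L + r') = m ∧
    aKer L 0 (x + ey L) + aKer L 0 r' - aKer L 0 (x + ey L + r') = m := by
  have h1 := nn_sum_aKer_zero L hL x
  have h2 := nn_sum_aKer_zero L hL (x + r')
  have hxr' : x + r' ≠ 0 := fun h => hxr (eq_neg_of_add_eq_zero_left h)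
  rw [if_neg hx0] at h1
  rw [if_neg hxr'] at h2
  rw [nnList_map_sum] at h1 h2
  have k1 : x + r' + ex L = x + ex L + r' := by abel
  have k2 : x + r' + -ex L = x + -ex L + r' := by abel
  have k3 : x + r' + ey L = x + ey L + r' := by abel
  have k4 : x + r' + -ey L = x + -ey L + r' := by abel
  rw [k1, k2, k3, k4] at h2
  have g1 := hmin (x + ex L)
  have g2 := hmin (x + -ex L)
  have g3 := hmin (x + ey L)
  have g4 := hmin (x + -ey L)
  constructor <;> linarith

/-- closure of the min-set under the two lattice generators reaches every site. [folklore] -/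
theorem min_everywhere (hL : 2 ≤ L) (r' : Tor L) {m : ℝ}
    (hmin : ∀ x : Tor L, m ≤ aKer L 0 x + aKer L 0 r' - aKer L 0 (x + r'))
    (h0 : m < aKer L 0 0 + aKer L 0 r' - aKer L 0 (0 + r'))
    (hr : m < aKer L 0 (-r') + aKer L 0 r' - aKer L 0 (-r' + r'))
    {x : Tor L} (hx : aKer L 0 x + aKer L 0 r' - aKer L 0 (x + r') = m) :
    ∀ y : Tor L, aKer L 0 y + aKer L 0 r' - aKer L 0 (y + r') = m := by
  -- every minimiser is off `{0, −r'}`, so the min-set is closed under the steps `+x̂`, `+ŷ`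
  have step : ∀ z : Tor L, aKer L 0 z + aKer L 0 r' - aKer L 0 (z + r') = m →
      aKer L 0 (z + ex L) + aKer L 0 r' - aKer L 0 (z + ex L + r') = m ∧
      aKer L 0 (z + ey L) + aKer L 0 r' - aKer L 0 (z + ey L + r') = m := by
    intro z hz
    have hz0 : z ≠ 0 := by rintro rfl; exact absurd hz (ne_of_gt h0)
    have hzr : z ≠ -r' := by rintro rfl; exact absurd hz (ne_of_gt hr)
    exact min_propagates L hL r' hmin hz hz0 hzr
  -- march along x, then along y
  have hX : ∀ n : ℕ, aKer L 0 (x + ((n : ZMod L), 0)) + aKer L 0 r' - aKer L 0 (x + ((n : ZMod L), 0) + r') = m := by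
    intro n
    induction n with
    | zero =>
      have e : (((0 : ℕ) : ZMod L), (0 : ZMod L)) = (0 : Tor L) := by simp [Prod.ext_iff]
      rw [e, add_zero]; exact hx
    | succ n ih =>
      have h := (step _ ih).1
      have e : ((n : ZMod L), (0 : ZMod L)) + ex L = (((n + 1 : ℕ) : ZMod L), 0) := by
        unfold ex; ext <;> simp
      rw [add_assoc, e] at h
      exact h
  have hXY : ∀ n k : ℕ, aKer L 0 (x + ((n : ZMod L), (k : ZMod L))) + aKer L 0 r'
      - aKer L 0 (x + ((n : ZMod L), (k : ZMod L)) + r') = m := by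
    intro n k
    induction k with
    | zero =>
      have e : (((n : ℕ) : ZMod L), ((0 : ℕ) : ZMod L)) = (((n : ℕ) : ZMod L), (0 : ZMod L)) := by simp
      rw [e]; exact hX n
    | succ k ih =>
      have h := (step _ ih).2
      have e : ((n : ZMod L), (k : ZMod L)) + ey L = (((n : ℕ) : ZMod L), (((k + 1 : ℕ)) : ZMod L)) := by
        unfold ey; ext <;> simp
      rw [add_assoc, e] at h
      exact h
  intro y
  have hy : y = x + ((((y - x).1.val : ℕ) : ZMod L), (((y - x).2.val : ℕ) : ZMod L)) := by
    rw [ZMod.natCast_zmod_val, ZMod.natCast_zmod_val]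
    ext <;> simp
  rw [hy]
  exact hXY _ _

/-- ★ `a₀(x + r′) ≤ a₀(x) + a₀(r′)` (`L ≥ 2`). [folklore] -/
theorem kernel_subadditive_of_two_le (hL : 2 ≤ L) (x r' : Tor L) :
    aKer L 0 (x + r') ≤ aKer L 0 x + aKer L 0 r' := by
  -- the minimum of `h`
  obtain ⟨z, -, hz⟩ := Finset.exists_min_image Finset.univ
    (fun y : Tor L => aKer L 0 y + aKer L 0 r' - aKer L 0 (y + r')) ⟨0, Finset.mem_univ _⟩
  set m := aKer L 0 z + aKer L 0 r' - aKer L 0 (z + r') with hm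
  have hmin : ∀ y : Tor L, m ≤ aKer L 0 y + aKer L 0 r' - aKer L 0 (y + r') := fun y => hz y (Finset.mem_univ y)
  -- `h(0) = 0`, `h(−r') = 2a₀(r') ≥ 0`
  have v0 : aKer L 0 0 + aKer L 0 r' - aKer L 0 (0 + r') = 0 := by rw [OneHoleTorus.aKer_zero, zero_add]; ring
  have vr : aKer L 0 (-r') + aKer L 0 r' - aKer L 0 (-r' + r') = 2 * aKer L 0 r' := by
    rw [OneHoleTorus.aKer_neg, neg_add_cancel, OneHoleTorus.aKer_zero]; ring
  have har : 0 ≤ aKer L 0 r' := aKer_zero_nonneg L hL r'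
  -- the minimum is `≥ 0`
  have hm0 : 0 ≤ m := by
    by_contra hneg
    have hneg' : m < 0 := lt_of_not_ge hneg
    have h0 : m < aKer L 0 0 + aKer L 0 r' - aKer L 0 (0 + r') := by rw [v0]; exact hneg'
    have hr : m < aKer L 0 (-r') + aKer L 0 r' - aKer L 0 (-r' + r') := by rw [vr]; linarith
    have hall := min_everywhere L hL r' hmin h0 hr hm.symm 0
    linarith
  linarith [hmin x]

/-- ★ `a₀(r + r′) ≤ a₀(r) + a₀(r′)` for every `L`. [folklore] -/
theorem kernel_subadditive (r r' : Tor L) : aKer L 0 (r + r') ≤ aKer L 0 r + aKer L 0 r' := by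
  by_cases hL : 2 ≤ L
  · exact kernel_subadditive_of_two_le L hL r r'
  · -- `L = 1`: the torus is a point
    have hL1 : L = 1 := by have := NeZero.ne L; omega
    subst hL1
    have hr : r = 0 := Subsingleton.elim _ _
    have hr' : r' = 0 := Subsingleton.elim _ _
    rw [hr, hr', add_zero, OneHoleTorus.aKer_zero]
    linarith

end RowC

/-- ★ **`KernelSubadditive L` holds (every `L`).** [folklore] -/
theorem kernelSubadditive_holds : KernelSubadditive L :=
  fun r r' => RowC.kernel_subadditive L r r'

end Summit.HubbardSuperconductivity.HubbardSuperconductivity.Theorems.AnisotropyChord.Transfer.Fibre3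

end
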